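import Mathlib
import Summits.Ventures.PercRepro2.SevenKernel

/-!
# The twelve-edge Kronecker certificates on seven-vertex skeletons, non-adjacent two-hub family part 17: `hub2_47`, `hub2_48`
(blind cell PercRepro2, mine-2 g34; `SevenKernel.lean` carries the definitions; the bridge `SevenTyped.HCov_seven`
turns each certificate into (HCOV) on the skeleton for every weight vector)

THE NON-ADJACENT TWO-HUB FAMILY `hub2 i j` (`i < j` in `Fin 10`): the unmarked vertices `u = 5` and `w = 6` joined to
every mark (edges `0..4` at `u`, `5..9` at `w`), NOT adjacent, and TWO mark–mark edges — the `i`-th and the `j`-th of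
the ten pairs of marks in lexicographic order (edges `10`, `11`); the 45 skeletons `hub2_ij`.  Together with THEOREM
33 (`SevenHub.lean`: hubs adjacent, one mark–mark edge) they give (HCOV) for every weight vector on every seven-vertex
graph whose two unmarked vertices are joined to any marks and the marks span at most two edges when the hubs are
non-adjacent (at most one when adjacent).  Marks `(o, a₁, a₂, a₃, b) = (0, 1, 2, 3, 4)`.  Census twin of every
certificate: mining/mine-2/code/g34/typed7.c: positive / zero / maximum class sums in the docstrings, 0 negative on
every skeleton.
-/

namespace Summit.Ventures.PercRepro2

namespace Seven

/-- **The non-adjacent two-hub skeleton `hub2_47`** (mask `1011312`): `u`, `w` joined to every mark, not adjacent, and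
the mark–mark edges `a₁ a₂`, `a₂ a₃`: the edges `ou a₁u a₂u a₃u bu ow a₁w a₂w a₃w bw a₁a₂ a₂a₃`. -/
def hub2_47 : Fin 12 → Fin 7 × Fin 7 :=
  ![(0, 5), (1, 5), (2, 5), (3, 5), (4, 5), (0, 6), (1, 6), (2, 6), (3, 6), (4, 6), (1, 2), (2, 3)]

set_option maxRecDepth 100000 in
/-- **The certificate of `hub2_47`**: every typed three-copy class sum is `≥ 0`, by one `decide +kernel`
(twin: 325,612 positive class sums, 16,451,604 zeros, maximum 8,800, 0 negative). -/
theorem cert_hub2_47 : Cert hub2_47 := by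
  unfold Cert
  decide +kernel

/-- **The non-adjacent two-hub skeleton `hub2_48`** (mask `1013360`): `u`, `w` joined to every mark, not adjacent, and
the mark–mark edges `a₁ a₂`, `a₂ b`: the edges `ou a₁u a₂u a₃u bu ow a₁w a₂w a₃w bw a₁a₂ a₂b`. -/
def hub2_48 : Fin 12 → Fin 7 × Fin 7 :=
  ![(0, 5), (1, 5), (2, 5), (3, 5), (4, 5), (0, 6), (1, 6), (2, 6), (3, 6), (4, 6), (1, 2), (2, 4)]

set_option maxRecDepth 100000 in
/-- **The certificate of `hub2_48`**: every typed three-copy class sum is `≥ 0`, by one `decide +kernel`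
(twin: 363,765 positive class sums, 16,413,451 zeros, maximum 11,148, 0 negative). -/
theorem cert_hub2_48 : Cert hub2_48 := by
  unfold Cert
  decide +kernel

end Seven

end Summit.Ventures.PercRepro2
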